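import Mathlib.Analysis.SpecialFunctions.Pow.Asymptotics
import Literature.RepresentationTheory.FiniteGroups.CharacterDegrees

/-!
# Stub `stub_shareUniversality` of crux `LevelGradedCohnUmans.GradedDesignFamily`
# (Mathlib-API route, siege k5)

An independent, character-free proof of the registered stub `stub_shareUniversality`
(crux item stmt-MatrixMultiplication-7610, line `Sketch`): shared-wall families with a fixed filling
fraction `c > 0` — for every ratio `R` a finite host `G`, a bi-invariant test space `J ≤ ℂ^G`, the
wall `B₂ = Σ_{χ ∈ Irr G ∩ J} χ(1)² > 0`, `t ≥ 1` simultaneously `J`-separated pieces of volume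
`≥ c (B₂/t)^{3/2}` each, and `R t χ(1)² ≤ B₂` for every visible irreducible `χ` — give, for every
`ε > 0`, a graded simultaneous family at exponent `2 + ε`:
`Σ_{χ ∈ Irr G ∩ J} χ(1)^{2+ε} < Σ_i (|X_i| |Y_i| |Z_i|)^{(2+ε)/3}`.

Design (the "Mathlib API" variation).  The statement mentions irreducible characters only through
the index set `irrChars G ∩ J` of two `finsum`s, and the proof below treats that set as an ARBITRARY
set: no character theory is imported or used (not even finiteness of `Irr G`, nor positivity of the
degrees `χ(1)`).
* Finiteness of the summation range is read off the hypothesis `0 < B₂` with Mathlib's `finsum`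
  API (`finsum_mem_def`, `finsum_of_infinite_support`, `finsum_mem_eq_sum`,
  `finsum_mem_eq_sum_of_subset`): an infinite support would make the wall `0`.
* The termwise budget bound `d^{2+ε} ≤ d² · M^{ε/2}` (`d² ≤ M`) is proved for every real `d`, signs
  included, through `Real.abs_rpow_le_abs_rpow`.
* The ratio `R` with `R^{-ε/2} < c^{(2+ε)/3}` comes from the filter statement
  `tendsto_rpow_neg_atTop` rather than from an explicit formula.
* The value side is `Finset.card_nsmul_le_sum`.
The arithmetic is the power-mean bookkeeping of [cite: CohnKleinbergSzegedyUmans2005, Thm. 5.5]: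
budget `≤ B₂ (B₂/t)^{ε/2} R^{-ε/2}`, value
`≥ t c^{(2+ε)/3} (B₂/t)^{(2+ε)/2} = c^{(2+ε)/3} B₂ (B₂/t)^{ε/2}`.
-/

-- Single-conjunct summit: `Summit.MatrixMultiplication.MatrixMultiplication` repeats by design
-- (D-0017), which `linter.dupNamespace` would flag on every declaration.
set_option linter.dupNamespace false

namespace Summit.MatrixMultiplication.MatrixMultiplication.Theorems.GradedDesignFamily.ShareUniversalityK5

open Filter Topology

/-- Choice of the ratio, filter-style: for `a > 0` and `y > 0` some `R > 0` has `R^{-y} < a`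
(because `R ↦ R^{-y}` tends to `0` at `+∞`, `tendsto_rpow_neg_atTop`). [folklore] -/
theorem exists_ratio {a y : ℝ} (ha : 0 < a) (hy : 0 < y) : ∃ R : ℝ, 0 < R ∧ R ^ (-y) < a := by
  obtain ⟨R, hRa, hR0⟩ :=
    (((tendsto_rpow_neg_atTop hy).eventually (gt_mem_nhds ha)).and (eventually_gt_atTop 0)).exists
  exact ⟨R, hR0, hRa⟩

/-- Termwise budget bound, valid for EVERY real `d` (no sign hypothesis): if `d² ≤ M` and `0 ≤ e`
then `d^{2+e} ≤ d² · M^{e/2}`.  For `d < 0` the real power `d^{2+e}` is bounded by `|d|^{2+e}`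
(`Real.abs_rpow_le_abs_rpow`), and `|d|^{2+e} = d² (d²)^{e/2} ≤ d² M^{e/2}`. [folklore] -/
theorem rpow_two_add_le {d M e : ℝ} (hM : d ^ 2 ≤ M) (he : 0 ≤ e) :
    d ^ (2 + e) ≤ d ^ 2 * M ^ (e / 2) := by
  have h2e : (0 : ℝ) < 2 + e := by linarith
  have h1 : |d| ^ e = (d ^ 2) ^ (e / 2) := by
    rw [← sq_abs, ← Real.rpow_two, ← Real.rpow_mul (abs_nonneg d)]
    congr 1
    ring
  calc d ^ (2 + e) ≤ |d ^ (2 + e)| := le_abs_self _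
    _ ≤ |d| ^ (2 + e) := Real.abs_rpow_le_abs_rpow d (2 + e)
    _ = d ^ 2 * (d ^ 2) ^ (e / 2) := by
        rw [Real.rpow_add' (abs_nonneg d) h2e.ne', Real.rpow_two, sq_abs, h1]
    _ ≤ d ^ 2 * M ^ (e / 2) :=
        mul_le_mul_of_nonneg_left (Real.rpow_le_rpow (sq_nonneg d) hM (by linarith)) (sq_nonneg d)

/-- **Character-free core.**  For an ARBITRARY index set `S` with real weights `d`, a wall
`B = ∑ᶠ_{χ ∈ S} (d χ)² > 0` (a `finsum`; its positivity forces the summation range to be finite),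
`t ≥ 1` values `V i ≥ c (B/t)^{3/2}` (`c > 0`), and a ratio `R > 0` with `R t (d χ)² ≤ B` on `S`
and `R^{-ε/2} < c^{(2+ε)/3}` (`ε > 0`):  `∑ᶠ_{χ ∈ S} (d χ)^{2+ε} < ∑_i (V i)^{(2+ε)/3}`.
Power-mean bookkeeping of [cite: CohnKleinbergSzegedyUmans2005, Thm. 5.5], via Mathlib's
`finsum` API. -/
theorem finsum_rpow_lt_sum_rpow {α : Type*} (S : Set α) (d : α → ℝ) {t : ℕ} (V : Fin t → ℝ)
    {c R B ε : ℝ} (hc : 0 < c) (hε : 0 < ε) (hR : 0 < R)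
    (hkey : R ^ (-(ε / 2)) < c ^ ((2 + ε) / 3)) (ht : 1 ≤ t)
    (hB : B = ∑ᶠ χ ∈ S, d χ ^ (2 : ℝ)) (hB0 : 0 < B)
    (hdeg : ∀ χ ∈ S, R * t * d χ ^ 2 ≤ B)
    (hvol : ∀ i, c * (B / t) ^ (3 / 2 : ℝ) ≤ V i) :
    ∑ᶠ χ ∈ S, d χ ^ (2 + ε) < ∑ i, V i ^ ((2 + ε) / 3) := by
  have h2e : (2 : ℝ) + ε ≠ 0 := by linarith
  have htpos : (0 : ℝ) < t := by exact_mod_cast ht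
  have hRt : 0 < R * t := mul_pos hR htpos
  have hP : 0 < B / t := div_pos hB0 htpos
  -- (0) `0 < B` forces the support of the wall to be finite
  have hfin : (S ∩ Function.support fun χ => d χ ^ (2 : ℝ)).Finite := by
    refine Set.not_infinite.mp fun hinf => ?_
    rw [finsum_mem_def, finsum_of_infinite_support (by rwa [Set.support_indicator])] at hB
    linarith
  set F := hfin.toFinset
  have hmemF : ∀ χ ∈ F, χ ∈ S := fun χ hχ => (hfin.mem_toFinset.mp hχ).1
  -- (1) both `finsum`s are finite sums over `F`
  have hBsum : B = ∑ χ ∈ F, d χ ^ 2 := by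
    rw [hB, finsum_mem_eq_sum _ hfin]
    exact Finset.sum_congr rfl fun χ _ => Real.rpow_two _
  have hSsum : ∑ᶠ χ ∈ S, d χ ^ (2 + ε) = ∑ χ ∈ F, d χ ^ (2 + ε) := by
    refine finsum_mem_eq_sum_of_subset _ (fun χ hχ => ?_) (fun χ hχ => hmemF χ hχ)
    rw [Finset.mem_coe, Set.Finite.mem_toFinset]
    refine ⟨hχ.1, fun h0 => hχ.2 ?_⟩
    have hd : d χ = 0 := (pow_eq_zero_iff two_ne_zero).mp ((Real.rpow_two (d χ)) ▸ h0)
    change d χ ^ (2 + ε) = 0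
    rw [hd, Real.zero_rpow h2e]
  -- (2) budget: `∑_F d^{2+ε} ≤ B (B/(Rt))^{ε/2}`
  have hbud : ∑ χ ∈ F, d χ ^ (2 + ε) ≤ B * (B / (R * t)) ^ (ε / 2) := by
    calc ∑ χ ∈ F, d χ ^ (2 + ε) ≤ ∑ χ ∈ F, d χ ^ 2 * (B / (R * t)) ^ (ε / 2) :=
          Finset.sum_le_sum fun χ hχ =>
            rpow_two_add_le ((le_div_iff₀' hRt).mpr (hdeg χ (hmemF χ hχ))) hε.le
      _ = B * (B / (R * t)) ^ (ε / 2) := by rw [← Finset.sum_mul, ← hBsum]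
  -- (3) value: termwise `c^{(2+ε)/3} (B/t)^{(2+ε)/2} = (c (B/t)^{3/2})^{(2+ε)/3} ≤ V_i^{(2+ε)/3}`,
  --     summed as `t • (c^{(2+ε)/3} (B/t)^{(2+ε)/2}) ≤ ∑_i V_i^{(2+ε)/3}`
  have hterm : ∀ i, c ^ ((2 + ε) / 3) * (B / t) ^ ((2 + ε) / 2) ≤ V i ^ ((2 + ε) / 3) := by
    intro i
    have h0 : 0 ≤ c * (B / t) ^ (3 / 2 : ℝ) := mul_nonneg hc.le (Real.rpow_nonneg hP.le _)
    calc c ^ ((2 + ε) / 3) * (B / t) ^ ((2 + ε) / 2)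
          = (c * (B / t) ^ (3 / 2 : ℝ)) ^ ((2 + ε) / 3) := by
          rw [Real.mul_rpow hc.le (Real.rpow_nonneg hP.le _), ← Real.rpow_mul hP.le,
            show (3 / 2 : ℝ) * ((2 + ε) / 3) = (2 + ε) / 2 by ring]
      _ ≤ V i ^ ((2 + ε) / 3) := Real.rpow_le_rpow h0 (hvol i) (by linarith)
  have hval : (t : ℝ) * (c ^ ((2 + ε) / 3) * (B / t) ^ ((2 + ε) / 2)) ≤
      ∑ i, V i ^ ((2 + ε) / 3) := by
    have h := Finset.card_nsmul_le_sum (Finset.univ : Finset (Fin t))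
      (fun i => V i ^ ((2 + ε) / 3)) (c ^ ((2 + ε) / 3) * (B / t) ^ ((2 + ε) / 2))
      fun i _ => hterm i
    rwa [Finset.card_univ, Fintype.card_fin, nsmul_eq_mul] at h
  -- (4) comparison of the two bounds
  have e1 : (B / (R * t)) ^ (ε / 2) = (B / t) ^ (ε / 2) * R ^ (-(ε / 2)) := by
    rw [Real.rpow_neg hR.le, ← Real.inv_rpow hR.le, ← Real.mul_rpow hP.le (inv_nonneg.mpr hR.le)]
    congr 1
    ring
  have e2 : (t : ℝ) * (c ^ ((2 + ε) / 3) * (B / t) ^ ((2 + ε) / 2)) =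
      B * (B / t) ^ (ε / 2) * c ^ ((2 + ε) / 3) := by
    rw [show (2 + ε) / 2 = 1 + ε / 2 by ring, Real.rpow_add hP, Real.rpow_one]
    field_simp
  have hpos : 0 < B * (B / t) ^ (ε / 2) := mul_pos hB0 (Real.rpow_pos_of_pos hP _)
  calc ∑ᶠ χ ∈ S, d χ ^ (2 + ε) = ∑ χ ∈ F, d χ ^ (2 + ε) := hSsum
    _ ≤ B * (B / (R * t)) ^ (ε / 2) := hbud
    _ = B * (B / t) ^ (ε / 2) * R ^ (-(ε / 2)) := by rw [e1, mul_assoc]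
    _ < B * (B / t) ^ (ε / 2) * c ^ ((2 + ε) / 3) := mul_lt_mul_of_pos_left hkey hpos
    _ = (t : ℝ) * (c ^ ((2 + ε) / 3) * (B / t) ^ ((2 + ε) / 2)) := e2.symm
    _ ≤ ∑ i, V i ^ ((2 + ε) / 3) := hval

/-- **stub_shareUniversality — splitting the wall among `t` pieces is free** (registered stub of
crux stmt-MatrixMultiplication-7610, proved verbatim; Mathlib-API route).  Shared-wall families —
a fixed filling fraction `c > 0` and, for every ratio `R`, a finite host `G` with a bi-invariant
test space `J ≤ ℂ^G`, wall `B₂ = Σ_{χ ∈ Irr G ∩ J} χ(1)² > 0`, `t ≥ 1` simultaneously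
`J`-separated pieces `(X_i, Y_i, Z_i)` each of volume `≥ c (B₂/t)^{3/2}`, and `R t χ(1)² ≤ B₂`
for every visible irreducible `χ` — yield, for every `ε > 0`, a graded simultaneous family at
exponent `2 + ε`: `Σ_{χ ∈ Irr H ∩ J} χ(1)^{2+ε} < Σ_i (|X_i| |Y_i| |Z_i|)^{(2+ε)/3}`.  Take the
member of the family at a ratio `R` with `R^{-ε/2} < c^{(2+ε)/3}` (`exists_ratio`), keep
`(G, J, X, Y, Z)`, and apply the character-free core `finsum_rpow_lt_sum_rpow`.
[cite: CohnKleinbergSzegedyUmans2005, Thm. 5.5] -/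
theorem stub_shareUniversality (c : ℝ) (hc : 0 < c)
    (hfam : ∀ R : ℝ, ∃ (G : Type) (_ : Group G) (_ : Fintype G) (J : Submodule ℂ (G → ℂ))
      (B₂ : ℝ) (t : ℕ) (X Y Z : Fin t → Finset G),
      B₂ = (∑ᶠ χ ∈ Literature.RepresentationTheory.FiniteGroups.irrChars G ∩ (J : Set (G → ℂ)),
        (χ 1).re ^ (2 : ℝ)) ∧
      (∀ f ∈ J, ∀ a b : G, (fun g : G => f (a * g * b)) ∈ J) ∧
      (∀ i : Fin t, ∀ x₀ ∈ X i, ∀ z₀ ∈ Z i, ∃ f ∈ J, ∀ j k : Fin t,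
        ∀ x ∈ X j, ∀ y ∈ Y j, ∀ y' ∈ Y k, ∀ z ∈ Z k,
          ((j = i ∧ k = i ∧ x = x₀ ∧ y = y' ∧ z = z₀) → f (x⁻¹ * y * y'⁻¹ * z) = 1) ∧
          (¬ (j = i ∧ k = i ∧ x = x₀ ∧ y = y' ∧ z = z₀) → f (x⁻¹ * y * y'⁻¹ * z) = 0)) ∧
      1 ≤ t ∧ 0 < B₂ ∧
      (∀ i, c * (B₂ / t) ^ (3 / 2 : ℝ) ≤ ((((X i).card * (Y i).card * (Z i).card : ℕ) : ℝ))) ∧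
      (∀ χ ∈ Literature.RepresentationTheory.FiniteGroups.irrChars G ∩ (J : Set (G → ℂ)),
        R * t * (χ 1).re ^ 2 ≤ B₂))
    (ε : ℝ) (hε : 0 < ε) :
    ∃ (H : Type) (_ : Group H) (_ : Fintype H) (J : Submodule ℂ (H → ℂ)) (n : ℕ)
      (X Y Z : Fin n → Finset H),
      (∀ f ∈ J, ∀ a b : H, (fun g : H => f (a * g * b)) ∈ J) ∧
      (∀ i : Fin n, ∀ x₀ ∈ X i, ∀ z₀ ∈ Z i, ∃ f ∈ J, ∀ j k : Fin n,
        ∀ x ∈ X j, ∀ y ∈ Y j, ∀ y' ∈ Y k, ∀ z ∈ Z k,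
          ((j = i ∧ k = i ∧ x = x₀ ∧ y = y' ∧ z = z₀) → f (x⁻¹ * y * y'⁻¹ * z) = 1) ∧
          (¬ (j = i ∧ k = i ∧ x = x₀ ∧ y = y' ∧ z = z₀) → f (x⁻¹ * y * y'⁻¹ * z) = 0)) ∧
      (∑ᶠ χ ∈ Literature.RepresentationTheory.FiniteGroups.irrChars H ∩ (J : Set (H → ℂ)),
        (χ 1).re ^ (2 + ε)) <
        ∑ i, ((((X i).card * (Y i).card * (Z i).card : ℕ) : ℝ) ^ ((2 + ε) / 3)) := by
  obtain ⟨R, hR, hkey⟩ := exists_ratio (Real.rpow_pos_of_pos hc ((2 + ε) / 3)) (half_pos hε)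
  obtain ⟨G, _instG, _instF, J, B₂, t, X, Y, Z, hB, hJ, hsep, ht, hB0, hvol, hdeg⟩ := hfam R
  exact ⟨G, inferInstance, inferInstance, J, t, X, Y, Z, hJ, hsep,
    finsum_rpow_lt_sum_rpow
      (Literature.RepresentationTheory.FiniteGroups.irrChars G ∩ (J : Set (G → ℂ)))
      (fun χ => (χ 1).re) (fun i => (((X i).card * (Y i).card * (Z i).card : ℕ) : ℝ))
      hc hε hR hkey ht hB hB0 hdeg hvol⟩

end Summit.MatrixMultiplication.MatrixMultiplication.Theorems.GradedDesignFamily.ShareUniversalityK5
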